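import Mathlib
import HarnessLib
import Summits.HubbardSuperconductivity.HubbardSuperconductivity.Theorems.KLProgrammeKLRegimeEngineTowerLevBaseFDisc
import Summits.HubbardSuperconductivity.HubbardSuperconductivity.Theorems.KLProgrammeKLRegimeEngineCutoffKernelNormsWtAtFamily

/-!
# Route `KLProgramme` — crux K3 ENGINE (stmt-HubbardSuperconductivity-20437 `KLRegimeEngineV17F2`), stub (b) v2, THE LEVELS PACKAGE (ℓ):
# «(ℓ)-BASE-F-WGRID» — the base datum of the floor-keyed law READ FROM p3's weighted grid step at `(Λ_d, F_{d−1})` BY NAME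
# (cell gate-hubbard-kl, seat hubbard-kl-k3c3-p2 g15; `klWtPinnedSumAt_klEffectiveAction_fam_le_of_wgridStep` (…CutoffKernelNormsWtAtFamily, p3 g20) ∘
#  `wgridBudget_bigraded_le` ∘ `klTowerBLevF_le_law_lev_of_doors_of_wgrid` (…TowerLevBaseFDisc, k3c3-p2 g15))

`klTowerBLevF_le_law_lev_of_doors_of_wgrid` takes the base of the re-based tower as an abstract bi-graded weighted grid datum (`N_w`, `A_g`, `P_g`).  p3's
`(cutoff, family, rate)`-generic weighted grid step delivers exactly such a datum for `𝒱_d = klEffectiveAction … klE0 d` analysed by `E(F_{d−1})`, modulo ITS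
standard block constants at the cutoff `Λ_d = klScale klE0 d`: the replica Gram constant `κ` and the `gridLabelWt`-weighted rows/columns `α_w` of
`Sᵀ C^K_{>Λ_d} S`, a radius `ρ` with the smallness `θ_w < 1`, and the weighted overlap rows/columns `(c_r, c_c)` of `E(F_{d−1})·S`.  Here the two are composed:

* (inside the proof) p3's literal degree budget as a function of the degree (`0` in odd degrees) is nonnegative and bi-graded in degrees `2p ≥ 4`
  (`≤ ε^{2p−1}·A_g·P_g^p·|U|^{p−1}`, `wgridBudget_bigraded_le`, with `A_g = c_r·e·c_F/(c_c·c_g²)`, `P_g = c_c²·c_g/(ρ²(1−θ_w))`, `c_F = (e²(κ+ρ))⁴·|β|/(4M)`, `c_g = e·α_w·c_F/κ²`);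
* **`klTowerBLevF_le_law_lev_of_doors_of_wgridStep`** — the floor-keyed levelled law at `λ = B·ε_j` whose base input is p3's STEP HYPOTHESES at `(Λ_d, F_{d−1})`
  (`κ, α_w, ρ, θ_w < 1, c_r > 0, c_c > 0`), plus the imports `ι₁`, `ῑ₂/B`, the cell `X̄/B²`, the floor LINK `hstep`, blocking (d), `B ≥ B₀`, the two doors.
Compositions of landed theorems and real algebra; nothing about the model is asserted beyond them; nothing asserts (ℓ), any stub, K3 or superconductivity.
References: BGM 2006 §2.8 (2.83), (2.93)–(2.98), §3 (3.2)–(3.8) [cite: BenfattoGiulianiMastropietro2006]; Pedra–Salmhofer 2008 Thm 2.4 [cite: PedraSalmhofer2008].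
-/

noncomputable section

namespace Summit.HubbardSuperconductivity.HubbardSuperconductivity.Theorems.EngineV8

set_option linter.dupNamespace false -- summit = problem name (single-conjunct summit), D-0017

open Classical
open Real Finset Literature.MathematicalPhysics.QuantumLattice Literature.Probability.LatticeModels GrassmannAlgebra
open Literature.Probability.LatticeModels.BattleFederbush
open Literature.MathematicalPhysics.QuantumLattice.FermiRG
open Summit.HubbardSuperconductivity.HubbardSuperconductivity.Theorems.KLProgrammeLegKernels
open Summit.HubbardSuperconductivity.HubbardSuperconductivity.Theorems.KLRegimeSplit
open Summit.HubbardSuperconductivity.HubbardSuperconductivity.Theorems.KLRegimeWick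
open Summit.HubbardSuperconductivity.HubbardSuperconductivity.Theorems.TorusFourierL2
open Summit.HubbardSuperconductivity.HubbardSuperconductivity.Theorems.DispersionFlow

variable {L M : ℕ} [NeZero L] [NeZero M]

/-! ## The floor-keyed law from p3's step hypotheses at `(Λ_d, F_{d−1})` -/

/-- **THE FLOOR-KEYED RE-BASED LEVELLED TOWER LAW WITH ITS BASE READ FROM p3's WEIGHTED GRID STEP AT `(Λ_d, F_{d−1})`** (doors form, `λ = B·ε_j`, amplitudes by
`B ≥ B₀`): `klTowerBLevF_le_law_lev_of_doors_of_wgrid` with the datum `(N_w, A_g, P_g)` supplied by `klWtPinnedSumAt_klEffectiveAction_fam_le_of_wgridStep` at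
`(n, J) = (d, d−1)` (rate `jw`) modulo p3's step hypotheses at the cutoff `Λ_d`: Gram `κ`, weighted rows/columns `α_w`, radius `ρ`, smallness `θ_w < 1`, POSITIVE weighted
overlap constants `c_r, c_c`.  Equational binders (`A_g, P_g, Â_b, Q_b, …`) are instantiated with `rfl`. [cite: BenfattoGiulianiMastropietro2006, §2.8 (2.83), (2.93)-(2.98), §3 (3.2)-(3.8)] -/
theorem klTowerBLevF_le_law_lev_of_doors_of_wgridStep :
    ∃ C₁ C₂ : ℝ, 0 < C₁ ∧ 0 < C₂ ∧ ∀ R : RenConsts, R.WF2 → ∃ c₃' : ℝ, 0 < c₃' ∧ ∃ U₀' : ℝ, 0 < U₀' ∧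
      ∀ (P : SplitConsts) (c : ℝ), P.WF → 0 < c → c ≤ klEngC₃6 P R → c ≤ c₃' →
      ∀ μ ∈ klWindowC, ∀ U : ℝ, 0 < U → U ≤ klEngU₀9 P R c → U ≤ U₀' → ∀ β : ℝ, klBetaMin ≤ β → β ≤ Real.exp (c / U ^ 2) →
      ∀ K : TrigPolyC4v, FrameOK R U (nScales β) μ K → ∀ (L M : ℕ) [NeZero L] [NeZero M],
      klEngL₃ β U ≤ L → klEngM₃ β U L ≤ M → ∀ d Kb D : ℕ, 2 ≤ d → d * Kb - 1 ≤ nScales β + 1 → 3 ≤ D →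
      ∀ (cc : ℝ) (n j : ℕ), IsKLRegime U cc (-(n : ℤ)) → j ≤ n →
      ∀ (B : ℝ), 1 ≤ B →
      -- p3's weighted grid step hypotheses at the cutoff `Λ_d`, analysis family `F_{d−1}`, rate `jw`
      ∀ (jw : ℕ) (κ : ℝ), 0 < κ →
        IsGramBoundedR ((hubbardGridSub L M β (2 * (2 * M))).transpose * hubbardCovAboveCT L M β μ 0 K (klScale klE0 d) *
          hubbardGridSub L M β (2 * (2 * M))) κ →
      ∀ (αw : ℝ), 0 < αw →
        (∀ X, ∑ Y, ‖((hubbardGridSub L M β (2 * (2 * M))).transpose * hubbardCovAboveCT L M β μ 0 K (klScale klE0 d) *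
          hubbardGridSub L M β (2 * (2 * M))) X Y‖ * gridLabelWt L (2 * (2 * M)) β {gridLegPos X, gridLegPos Y} ≤ αw) →
        (∀ Y, ∑ X, ‖((hubbardGridSub L M β (2 * (2 * M))).transpose * hubbardCovAboveCT L M β μ 0 K (klScale klE0 d) *
          hubbardGridSub L M β (2 * (2 * M))) X Y‖ * gridLabelWt L (2 * (2 * M)) β {gridLegPos X, gridLegPos Y} ≤ αw) →
      ∀ (ρ : ℝ), 0 < ρ →
        Real.exp 1 * αw * normV (GridLeg (GridPoint L (2 * (2 * M)))) κ ρ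
          (fun m' : ℕ => if m' = 1 then |β| / (2 * (2 * M) : ℕ) * ∑ z : TorusSite 2 L, ‖framePosKernel L K z‖ * (1 + torusSiteDist z 0)
            else if m' = 2 then |U| * |β| / (2 * (2 * M) : ℕ) else 0) / κ ^ 2 < 1 →
      ∀ (crw ccw : ℝ), 0 < crw → 0 < ccw →
        (∀ X'' : SpaceTimeIdx L M × SectorLeg (sectorCount (d - 1)), ∑ X' : GridLeg (GridPoint L (2 * (2 * M))),
          ‖(sectorAnalysisMatrix L M β (klAnisoFamily L M β μ K klE0 (d - 1)) * hubbardGridSub L M β (2 * (2 * M))) X'' X'‖ *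
            gridLabelWt L (2 * (2 * M)) β {latticeLegPos (2 * (2 * M)) X'', gridLegPos X'} ≤ crw) →
        (∀ X' : GridLeg (GridPoint L (2 * (2 * M))), ∑ X'' : SpaceTimeIdx L M × SectorLeg (sectorCount (d - 1)),
          ‖(sectorAnalysisMatrix L M β (klAnisoFamily L M β μ K klE0 (d - 1)) * hubbardGridSub L M β (2 * (2 * M))) X'' X'‖ *
            gridLabelWt L (2 * (2 * M)) β {latticeLegPos (2 * (2 * M)) X'', gridLegPos X'} ≤ ccw) →
      -- the derived base constants (equational binders)
      ∀ (nV cF cg Ag Pg : ℝ),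
        nV = normV (GridLeg (GridPoint L (2 * (2 * M)))) κ ρ
          (fun m' : ℕ => if m' = 1 then |β| / (2 * (2 * M) : ℕ) * ∑ z : TorusSite 2 L, ‖framePosKernel L K z‖ * (1 + torusSiteDist z 0)
            else if m' = 2 then |U| * |β| / (2 * (2 * M) : ℕ) else 0) →
        cF = (Real.exp 2 * (κ + ρ)) ^ (2 * 2) * (|β| / (2 * (2 * M) : ℕ)) → cg = Real.exp 1 * αw * cF / κ ^ 2 →
        Ag = crw * Real.exp 1 * cF / (ccw * cg ^ 2) → Pg = ccw ^ 2 * cg / (ρ ^ 2 * (1 - Real.exp 1 * αw * nV / κ ^ 2)) →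
      ∀ (ι₂ X : ℝ), 0 ≤ ι₂ → 0 ≤ X →
      ∀ (Ab Qb Ab' ι₂' X' : ℝ), Ab = (2 : ℝ) ^ (7 * (d - 1)) * Ag / P.Klam ^ 2 → Qb = Pg / (8 : ℝ) ^ (d - 1) →
        Ab' = Ab / B ^ 2 → ι₂' = ι₂ / B → X' = X / B ^ 2 →
      ∀ (W Z σ Φ ψ τ ι₁ : ℝ), 0 < W → 0 < Z → 0 ≤ σ → 0 ≤ Φ → 0 ≤ ψ → 0 < τ → 0 ≤ ι₁ →
      ∀ (ρk Q' Q κA Yb Y A A' ι₃ : ℝ), ρk = max 4 (2 * τ * ψ) → Q' = Z * Qb + 1 → Q = ρk * Q' →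
        κA = W * ((27 : ℝ) ^ 5 * (C₁ / C₂) * (8 : ℝ) ^ (d - 1)) →
        Yb = ι₂ / (2 * Q') + W * Z ^ 3 * X / (4 * Q' ^ 2) + (W * (27 : ℝ) ^ 5 * Ab + κA * Ab) * Q' / 2 →
        Y = ι₂' / (2 * Q') + W * Z ^ 3 * X' / (4 * Q' ^ 2) + (W * (27 : ℝ) ^ 5 * Ab' + κA * Ab') * Q' / 2 →
        A = 2 * Y * (1 - ((2 : ℝ) ^ d)⁻¹) / (κA * Q') →
        A' = (W * (27 : ℝ) ^ 5 * Ab' + κA * Ab') + 2 * Y / Q' → ι₃ = W * Z ^ 3 * X' + A' * Q' ^ 3 →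
      max 1 Z * C₂ ^ 2 * max 4 (2 * τ * ψ) ≤ (2 : ℝ) ^ (d - 1) →
      max 1 (max (8 * Φ * τ * Yb) (128 * exp 1 * ψ ^ 3 * τ ^ 4 * Φ * κA * Yb / ((1 - ((2 : ℝ) ^ d)⁻¹) * ρk ^ 3))) ≤ B →
      (∀ k, 1 ≤ k → k < Kb → W * Z ^ 1 * klTowerMuLevF L M β U μ K d k 1 ≤ ι₁ * (B * epsCoupling P U j)) →
      (∀ k, 1 ≤ k → k < Kb → W * Z ^ 2 * klTowerMuLevF L M β U μ K d k 2 ≤ ι₂' * (B * epsCoupling P U j)) →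
      (∀ k, 2 ≤ k → k < Kb → klTowerMuLevAtF L M β U μ K d 0 k 3 ≤ X' * (B * epsCoupling P U j) ^ 2) →
      (∀ t : Fin 5, ∀ k, 1 ≤ k → k < Kb → ∀ N : ℕ, 2 ≤ N → ∀ p, 3 ≤ p → p ≤ D →
        Φ * towerV D τ (fun m => W * Z ^ m * klTowerMuLevF L M β U μ K d k m) < 1 →
        klTowerBLevF L M β U μ K d t (k + 1) p ≤
          towerFO D σ (fun m => W * Z ^ m * klTowerMuLevF L M β U μ K d k m) p +
            ∑ n ∈ Icc 2 N, exp 1 * Φ ^ (n - 1) * ψ ^ p * towerS D τ (fun m => W * Z ^ m * klTowerMuLevF L M β U μ K d k m) n p +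
            ψ ^ p * exp 1 * towerV D τ (fun m => W * Z ^ m * klTowerMuLevF L M β U μ K d k m) *
              (Φ * towerV D τ (fun m => W * Z ^ m * klTowerMuLevF L M β U μ K d k m)) ^ N /
              (1 - Φ * towerV D τ (fun m => W * Z ^ m * klTowerMuLevF L M β U μ K d k m))) →
      U ≤ min 1 (min (1 / (8 * σ * Q' + 1)) (min (1 / (2 * exp 1 * τ * Q' + 1)) (min (1 / (4 * Φ * τ * ι₁ + 1))
        (min (1 / (2 * (Φ * (exp 1 * τ * ι₁ + (exp 1 * τ) ^ 2 * ι₂' + (exp 1 * τ) ^ 3 * ι₃ + A' * (exp 1 * τ * Q') ^ 2 / 2)) + 1))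
          (min (A * Q ^ 3 / (16 * σ * Q' * A' * (4 * Q') ^ 3 + A * Q ^ 3))
            (A * Q ^ 3 / (16 * exp 1 * ψ * (2 * τ * ψ * Q') ^ 2 * Φ * τ ^ 2 * ι₁ ^ 2 + A * Q ^ 3))))))) / (2 * B * P.Klam + 1) →
      cc ≤ min 1 (min (1 / (8 * σ * Q' + 1)) (min (1 / (2 * exp 1 * τ * Q' + 1)) (min (1 / (4 * Φ * τ * ι₁ + 1))
        (min (1 / (2 * (Φ * (exp 1 * τ * ι₁ + (exp 1 * τ) ^ 2 * ι₂' + (exp 1 * τ) ^ 3 * ι₃ + A' * (exp 1 * τ * Q') ^ 2 / 2)) + 1))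
          (min (A * Q ^ 3 / (16 * σ * Q' * A' * (4 * Q') ^ 3 + A * Q ^ 3))
            (A * Q ^ 3 / (16 * exp 1 * ψ * (2 * τ * ψ * Q') ^ 2 * Φ * τ ^ 2 * ι₁ ^ 2 + A * Q ^ 3))))))) * Real.log 4 / (2 * B * P.Klam + 1) →
      ∀ k, 2 ≤ k → k ≤ Kb → ∀ (t : Fin 5) (p : ℕ), 3 ≤ p → p ≤ D →
        klTowerBLevF L M β U μ K d t k p ≤ A * (B * epsCoupling P U j) ^ (p - 1) * Q ^ p := by
  obtain ⟨C₁, C₂, hC₁, hC₂, h⟩ := klTowerBLevF_le_law_lev_of_doors_of_wgrid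
  refine ⟨C₁, C₂, hC₁, hC₂, fun R hR2 => ?_⟩
  obtain ⟨c₃, hc₃, U₀, hU₀, h'⟩ := h R hR2
  refine ⟨c₃, hc₃, U₀, hU₀, ?_⟩
  intro P c hP hc hc6 hc₃' μ hμ U hU hU9 hU₀' β hβmin hβc K hK L M _ _ hL3 hM3 d Kb D hd hKbN hD cc n j hreg hj B hB jw κ hκ hGB αw hαw hrow hcol ρ hρ hθ
    crw ccw hcrw hccw hrow' hcol' nV cF cg Ag Pg hnV hcF hcg hAg hPg ι₂ X hι₂ hX Ab Qb Ab' ι₂' X' hAb hQb hAb' hι₂' hX'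
    W Z σ Φ ψ τ ι₁ hW hZ hσ hΦ hψ hτ hι₁ ρk Q' Q κA Yb Y A A' ι₃ hρk hQ' hQ hκA hYb hY hA hA' hι₃ hblock hBle himp₁ himp₂ hcell hstep hUdoor hcdoor
  have hβ : 0 < β := KLRegimeSplit.pos_of_klBetaMin_le hβmin
  have hε : 0 ≤ imagTimeWeight β M := imagTimeWeight_nonneg hβ.le M
  have he : 0 < Real.exp 1 := Real.exp_pos 1
  have hMpos : (0 : ℝ) < (2 * (2 * M) : ℕ) := by
    have := NeZero.ne M
    exact_mod_cast (by omega : 0 < 2 * (2 * M))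
  -- the profile norm, the budget and its bi-graded reading
  have hθ' : Real.exp 1 * αw * nV / κ ^ 2 < 1 := by rw [hnV]; exact hθ
  have hnV0 : 0 ≤ nV := by
    rw [hnV]
    refine normV_nonneg hκ.le hρ.le (fun m' => ?_)
    split_ifs
    · exact mul_nonneg (by positivity) (sum_nonneg fun z _ => mul_nonneg (norm_nonneg _)
        (add_nonneg zero_le_one (by unfold torusSiteDist; exact Nat.cast_nonneg _)))
    · positivity
    · exact le_rfl
  set f : ℝ := (Real.exp 2 * (κ + ρ)) ^ (2 * 2) * (|U| * |β| / (2 * (2 * M) : ℕ)) with hfdef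
  have hf0 : 0 ≤ f := by positivity
  have hcF0 : 0 < cF := by rw [hcF]; have := abs_pos.2 hβ.ne'; positivity
  have hfu : f = cF * |U| := by rw [hfdef, hcF]; ring
  -- p3's literal degree budget (0 in odd degrees / degree 0)
  have h1θ : 0 < 1 - Real.exp 1 * αw * nV / κ ^ 2 := sub_pos.2 hθ'
  obtain ⟨Nlit, hNlit⟩ : ∃ Nlit : ℕ → ℝ, Nlit = fun m =>
      if m = 2 then imagTimeWeight β M ^ (2 - 1) * (crw * ccw ^ (2 - 1) * (ρ⁻¹ ^ 2 * (Real.exp 1 * nV) / (1 - Real.exp 1 * αw * nV / κ ^ 2)))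
      else if Even m ∧ 4 ≤ m then
        imagTimeWeight β M ^ (2 * (m / 2) - 1) * (crw * ccw ^ (2 * (m / 2) - 1) *
          (ρ⁻¹ ^ (2 * (m / 2)) * (Real.exp 1 * f) * (Real.exp 1 * αw * f / κ ^ 2) ^ (m / 2 - 2) / (1 - Real.exp 1 * αw * nV / κ ^ 2) ^ (m / 2)))
      else 0 := ⟨_, rfl⟩
  have hNlit_two : Nlit 2 = imagTimeWeight β M ^ (2 - 1) * (crw * ccw ^ (2 - 1) * (ρ⁻¹ ^ 2 * (Real.exp 1 * nV) / (1 - Real.exp 1 * αw * nV / κ ^ 2))) := by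
    rw [hNlit]; simp
  have hNlit_mul : ∀ p, 2 ≤ p → Nlit (2 * p) = imagTimeWeight β M ^ (2 * p - 1) * (crw * ccw ^ (2 * p - 1) *
      (ρ⁻¹ ^ (2 * p) * (Real.exp 1 * f) * (Real.exp 1 * αw * f / κ ^ 2) ^ (p - 2) / (1 - Real.exp 1 * αw * nV / κ ^ 2) ^ p)) := by
    intro p hp
    have h2 : 2 * p ≠ 2 := by omega
    have hev : Even (2 * p) ∧ 4 ≤ 2 * p := ⟨even_two_mul p, by omega⟩
    rw [hNlit]
    simp only [h2, if_false, hev, and_self, if_true, Nat.mul_div_cancel_left p two_pos]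
  have hNlit0 : ∀ m, 0 ≤ Nlit m := by
    intro m
    rw [hNlit]
    dsimp only
    split_ifs
    · positivity
    · positivity
    · exact le_rfl
  set Nw : ℕ → ℝ := fun p => Nlit (2 * p) with hNwdef
  have hNw0 : ∀ p, 0 ≤ Nw p := fun p => hNlit0 _
  -- p3's step: every weighted pinned sum of `𝒱_d` at `F_{d−1}` is within the budget
  have hp3 := klWtPinnedSumAt_klEffectiveAction_fam_le_of_wgridStep hβ U μ K d (d - 1) jw hκ hGB hαw hrow hcol hρ hθ hccw.le hrow' hcol'
    Nlit (fun m _ => hNlit0 m) (by rw [hNlit_two, hnV]) (fun p hp => by rw [hNlit_mul p hp, hnV])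
  have hgrid : ∀ p, 1 ≤ p → ∀ (q : Fin (2 * p)) (w : SpaceTimeIdx L M × SectorLeg (sectorCount (d - 1))),
      klWtPinnedSumAt L M β μ K (d - 1) jw (2 * p) (klTowerInput L M β U μ K d 1) q w ≤ Nw p := by
    intro p _ q w
    unfold klTowerInput
    rw [Nat.mul_one]
    exact hp3 (2 * p) q w
  have hAg0 : 0 < Ag := by
    have hcg0 : 0 < cg := by rw [hcg]; positivity
    rw [hAg]; positivity
  have hPg0 : 0 ≤ Pg := by
    have hcg0 : 0 < cg := by rw [hcg]; positivity
    have h1θ : 0 < 1 - Real.exp 1 * αw * nV / κ ^ 2 := sub_pos.2 hθ'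
    rw [hPg]; positivity
  have hbi : ∀ p, 3 ≤ p → Nw p ≤ imagTimeWeight β M ^ (2 * p - 1) * Ag * Pg ^ p * |U| ^ (p - 1) := by
    intro p hp
    have h := wgridBudget_bigraded_le (crw := crw) (θ := Real.exp 1 * αw * nV / κ ^ 2) hccw.le hρ hκ hαw hθ' hcF0 hfu (by omega : 2 ≤ p)
    rw [← hcg, ← hAg, ← hPg] at h
    calc Nw p = Nlit (2 * p) := rfl
      _ = imagTimeWeight β M ^ (2 * p - 1) * (crw * ccw ^ (2 * p - 1) *
          (ρ⁻¹ ^ (2 * p) * (Real.exp 1 * f) * (Real.exp 1 * αw * f / κ ^ 2) ^ (p - 2) / (1 - Real.exp 1 * αw * nV / κ ^ 2) ^ p)) :=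
          hNlit_mul p (by omega)
      _ ≤ imagTimeWeight β M ^ (2 * p - 1) * (Ag * Pg ^ p * |U| ^ (p - 1)) := mul_le_mul_of_nonneg_left h (pow_nonneg hε _)
      _ = imagTimeWeight β M ^ (2 * p - 1) * Ag * Pg ^ p * |U| ^ (p - 1) := by ring
  exact h' P c hP hc hc6 hc₃' μ hμ U hU hU9 hU₀' β hβmin hβc K hK L M hL3 hM3 d Kb D hd hKbN hD cc n j hreg hj B hB jw Nw hNw0 hgrid Ag Pg hAg0 hPg0 hbi
    ι₂ X hι₂ hX Ab Qb Ab' ι₂' X' hAb hQb hAb' hι₂' hX' W Z σ Φ ψ τ ι₁ hW hZ hσ hΦ hψ hτ hι₁ ρk Q' Q κA Yb Y A A' ι₃ hρk hQ' hQ hκA hYb hY hA hA' hι₃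
    hblock hBle himp₁ himp₂ hcell hstep hUdoor hcdoor

end Summit.HubbardSuperconductivity.HubbardSuperconductivity.Theorems.EngineV8
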